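import Mathlib.Analysis.InnerProductSpace.Projection.FiniteDimensional
import Mathlib.Analysis.InnerProductSpace.Projection.Minimal
import Mathlib.Analysis.Normed.Module.FiniteDimension
import Mathlib.LinearAlgebra.Complex.FiniteDimensional
import HarnessLib

/-!
# Nearly complex planes in a Hermitian vector space: adapted orthonormal bases

Topic `Literature/Geometry/Kaehler` (linear algebra of Kähler geometry). Let `F` be a
finite-dimensional real inner product space with an orthogonal, skew complex structure
`J : F →ₗᵢ[ℝ] F` (`⟪Jx, y⟫ = -⟪x, Jy⟫`; e.g. `J = i •` on a complex inner product space regarded as a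
real one, `⟪x, y⟫_ℝ = re ⟪x, y⟫`, see the last section). A real subspace `V ⊆ F` is *nearly complex
with defect `≤ t`* if every `v ∈ V` has some `w ∈ V` with `‖Jv - w‖ ≤ t ‖v‖` — the pointwise
condition `HasJDefectLE` of `Literature/Geometry/Kaehler/NearlyHolomorphicCycleSupport.lean` (there
for a Riemannian metric on a tangent space; a general metric is comparable to a `J`-Hermitian one,
to which this file applies), kept INLINE as a hypothesis (no definition is introduced). Defect `0`
means `JV ⊆ V`, a complex subspace; for a real `2`-plane the optimal `t` is `|sin α|`, `α` the
Kähler angle.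

Main result (all proved, no definitions, no named facts):

* `exists_adapted_orthonormal_of_defect` — **adapted orthonormal bases**: if `dim_ℝ V = 2m` and `V`
  has defect `≤ t` with `0 ≤ t`, `2 · 5ᵐ · t ≤ 1`, there are orthonormal vectors
  `e₁, f₁, …, e_m, f_m ∈ V` (an orthonormal basis of `V`) with `‖f_j - J e_j‖ ≤ 2 · 5ᵐ · t`.
  Greedy construction: `e ∈ V` a unit vector, `f` the normalised projection of `Je` to `V`
  (`‖P_V(Je) - Je‖ ≤ t` by minimality of the projection, `P_V(Je) ⊥ e` as `J` is skew;
  `exists_partner_of_defect`), then recurse in `V' = V ∩ e^⊥ ∩ f^⊥`, which is nearly complex with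
  defect `≤ 5t` (`defect_inf_orthogonal_le`);
* `exists_adapted_orthonormal_of_defect_complex` — the same for `J = i •` on a finite-dimensional
  complex inner product space (orthogonality read as `re ⟪·, ·⟫_ℂ = 0`; the real inner product
  structure `InnerProductSpace.complexToReal` is used inside the proof only).

This is the linear algebra behind "a nearly complex plane is `O(t)`-close to a complex plane" used
by the threshold lemma of the Hodge summit's route *HolomorphicityRate* (off-type forms are `O(t)`
on planes of defect `t`; Wirtinger's inequality with defect), cf. Harvey–Lawson (1982), §II.1
(Kähler angles of a `2p`-plane, Wirtinger's inequality) and McDuff–Salamon (2017), §2.5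
(compatible linear complex structures).

## References

* R. Harvey, H. B. Lawson, *Calibrated geometries*, Acta Math. 148 (1982), §II.1. [HarveyLawson1982]
* D. McDuff, D. Salamon, *Introduction to Symplectic Topology*, 3rd ed. (2017), §2.5. [McDuffSalamon2017]
-/

noncomputable section

open scoped InnerProductSpace
open Module Submodule

namespace Literature.Geometry.Kaehler

section SkewIsometry

variable {F : Type*} [NormedAddCommGroup F] [InnerProductSpace ℝ F]

/-! ### A skew isometry `J` -/

/-- A skew operator pairs every vector orthogonally with itself: `⟪Jx, x⟫ = 0`. [folklore] -/
theorem inner_self_eq_zero_of_skew {J : F →ₗᵢ[ℝ] F} (hJ : ∀ x y, ⟪J x, y⟫_ℝ = -⟪x, J y⟫_ℝ)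
    (x : F) : ⟪J x, x⟫_ℝ = 0 := by
  have h := hJ x x
  rw [real_inner_comm (J x) x] at h
  linarith

variable [FiniteDimensional ℝ F]

/-! ### The projection realises the defect -/

/-- **The orthogonal projection realises the defect**: if `V` is nearly complex with defect `≤ t`,
then for `v ∈ V` the orthogonal projection of `Jv` to `V` is within `t ‖v‖` of `Jv` (the
projection minimises the distance to `V`). [folklore] -/
theorem norm_sub_starProjection_le_of_defect (J : F →ₗᵢ[ℝ] F) {V : Submodule ℝ F} {t : ℝ}
    (hV : ∀ v ∈ V, ∃ w ∈ V, ‖J v - w‖ ≤ t * ‖v‖) {v : F} (hv : v ∈ V) :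
    ‖J v - V.starProjection (J v)‖ ≤ t * ‖v‖ := by
  obtain ⟨w, hw, hle⟩ := hV v hv
  rw [starProjection_minimal]
  exact (ciInf_le ⟨0, Set.forall_mem_range.2 fun _ ↦ norm_nonneg _⟩ ⟨w, hw⟩).trans hle

/-- The projection of `Jv` to `V` is orthogonal to `v` (for `v ∈ V`, `J` skew):
`⟪P_V(Jv), v⟫ = ⟪Jv, v⟫ = 0`. [folklore] -/
theorem inner_starProjection_self_eq_zero_of_skew {J : F →ₗᵢ[ℝ] F}
    (hJ : ∀ x y, ⟪J x, y⟫_ℝ = -⟪x, J y⟫_ℝ) {V : Submodule ℝ F} {v : F} (hv : v ∈ V) :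
    ⟪V.starProjection (J v), v⟫_ℝ = 0 := by
  rw [inner_starProjection_left_eq_right, starProjection_eq_self_iff.2 hv,
    inner_self_eq_zero_of_skew hJ]

/-! ### One step: a unit vector `e ∈ V` and its partner `f ≈ Je` -/

/-- **One adapted pair.** In a nearly complex `V` (defect `≤ t ≤ 1/2`) every unit vector `e ∈ V` has a
partner `f ∈ V`, a unit vector orthogonal to `e` with `‖f - Je‖ ≤ 2t`: normalise `u = P_V(Je)`, for
which `‖u - Je‖ ≤ t`, `⟪u, e⟫ = 0` and `|‖u‖ - 1| ≤ t`. [cite: McDuffSalamon2017, §2.5] -/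
theorem exists_partner_of_defect {J : F →ₗᵢ[ℝ] F} (hJ : ∀ x y, ⟪J x, y⟫_ℝ = -⟪x, J y⟫_ℝ)
    {V : Submodule ℝ F} {t : ℝ} (ht : t ≤ 1 / 2) (hV : ∀ v ∈ V, ∃ w ∈ V, ‖J v - w‖ ≤ t * ‖v‖)
    {e : F} (he : e ∈ V) (he1 : ‖e‖ = 1) :
    ∃ f ∈ V, ‖f‖ = 1 ∧ ⟪e, f⟫_ℝ = 0 ∧ ‖f - J e‖ ≤ 2 * t := by
  set u : F := V.starProjection (J e) with hu
  have huV : u ∈ V := starProjection_apply_mem V _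
  have hut : ‖J e - u‖ ≤ t := by simpa [he1] using norm_sub_starProjection_le_of_defect J hV he
  have hue : ⟪u, e⟫_ℝ = 0 := inner_starProjection_self_eq_zero_of_skew hJ he
  -- `|‖u‖ - 1| ≤ t`, so `‖u‖ ≥ 1/2 > 0`
  have hnorm : |‖u‖ - 1| ≤ t := by
    have h := abs_norm_sub_norm_le u (J e)
    rw [J.norm_map, he1, norm_sub_rev] at h
    exact h.trans hut
  have hu_pos : 0 < ‖u‖ := by
    have := (abs_le.1 hnorm).1
    linarith
  refine ⟨‖u‖⁻¹ • u, V.smul_mem _ huV, ?_, ?_, ?_⟩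
  · rw [norm_smul, norm_inv, norm_norm, inv_mul_cancel₀ hu_pos.ne']
  · rw [real_inner_smul_right, real_inner_comm, hue, mul_zero]
  · -- `‖u/‖u‖ - Je‖ ≤ ‖u/‖u‖ - u‖ + ‖u - Je‖ = |1 - ‖u‖| + ‖u - Je‖`
    have h1 : ‖‖u‖⁻¹ • u - u‖ = |1 - ‖u‖| := by
      have hsmul : ‖u‖⁻¹ • u - u = (‖u‖⁻¹ - 1) • u := by rw [sub_smul, one_smul]
      have habs : |‖u‖⁻¹ - 1| * ‖u‖ = |(‖u‖⁻¹ - 1) * ‖u‖| := by rw [abs_mul, abs_of_pos hu_pos]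
      rw [hsmul, norm_smul, Real.norm_eq_abs, habs, sub_mul, inv_mul_cancel₀ hu_pos.ne', one_mul]
    calc ‖‖u‖⁻¹ • u - J e‖ ≤ ‖‖u‖⁻¹ • u - u‖ + ‖u - J e‖ := norm_sub_le_norm_sub_add_norm_sub _ _ _
      _ ≤ t + t := by
          refine add_le_add ?_ (by rwa [norm_sub_rev] at hut)
          rw [h1, abs_sub_comm]
          exact hnorm
      _ = 2 * t := by ring

/-! ### Defect of the orthogonal complement of an adapted pair -/

/-- **Splitting off an adapted pair costs a factor `5` in the defect.** If `V` has defect `≤ t`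
and `e, f ∈ V` are orthonormal with `‖f - Je‖ ≤ 2t`, then `V' = V ∩ e^⊥ ∩ f^⊥` has defect `≤ 5t`:
for `v ∈ V'` and `w = P_V(Jv)`, the corrected vector `w - ⟪e, w⟫e - ⟪f, w⟫f ∈ V'` is within
`5t‖v‖` of `Jv`, because `⟪e, w⟫ = ⟪e, Jv⟫ = -⟪Je - f, v⟫` and `⟪f, w⟫ = ⟪f - Je, Jv⟫` are `O(t)`.
[cite: McDuffSalamon2017, §2.5] -/
theorem defect_inf_orthogonal_le {J : F →ₗᵢ[ℝ] F} (hJ : ∀ x y, ⟪J x, y⟫_ℝ = -⟪x, J y⟫_ℝ)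
    {V : Submodule ℝ F} {t : ℝ} (hV : ∀ v ∈ V, ∃ w ∈ V, ‖J v - w‖ ≤ t * ‖v‖) {e f : F}
    (he : e ∈ V) (hf : f ∈ V) (he1 : ‖e‖ = 1) (hf1 : ‖f‖ = 1) (hef : ⟪e, f⟫_ℝ = 0)
    (hfe : ‖f - J e‖ ≤ 2 * t) :
    ∀ v ∈ (ℝ ∙ f)ᗮ ⊓ ((ℝ ∙ e)ᗮ ⊓ V), ∃ w ∈ (ℝ ∙ f)ᗮ ⊓ ((ℝ ∙ e)ᗮ ⊓ V),
      ‖J v - w‖ ≤ (5 * t) * ‖v‖ := by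
  intro v hv
  obtain ⟨hvf, hve, hvV⟩ := (Submodule.mem_inf.1 hv).imp id Submodule.mem_inf.1
  rw [mem_orthogonal_singleton_iff_inner_right] at hvf hve
  set w : F := V.starProjection (J v) with hw
  have hwV : w ∈ V := starProjection_apply_mem V _
  have hwt : ‖J v - w‖ ≤ t * ‖v‖ := norm_sub_starProjection_le_of_defect J hV hvV
  -- the two small coefficients
  have hew : ⟪e, w⟫_ℝ = -⟪J e - f, v⟫_ℝ := by
    rw [hw, ← inner_starProjection_left_eq_right, starProjection_eq_self_iff.2 he, inner_sub_left,
      hvf, sub_zero, hJ, neg_neg]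
  have hfw : ⟪f, w⟫_ℝ = ⟪f - J e, J v⟫_ℝ := by
    rw [hw, ← inner_starProjection_left_eq_right, starProjection_eq_self_iff.2 hf, inner_sub_left,
      J.inner_map_map, hve, sub_zero]
  have hew_le : |⟪e, w⟫_ℝ| ≤ 2 * t * ‖v‖ := by
    rw [hew, abs_neg]
    refine (abs_real_inner_le_norm _ _).trans ?_
    rw [norm_sub_rev]
    exact mul_le_mul_of_nonneg_right hfe (norm_nonneg _)
  have hfw_le : |⟪f, w⟫_ℝ| ≤ 2 * t * ‖v‖ := by
    rw [hfw]
    refine (abs_real_inner_le_norm _ _).trans ?_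
    rw [J.norm_map]
    exact mul_le_mul_of_nonneg_right hfe (norm_nonneg _)
  -- the corrected vector
  refine ⟨w - ⟪e, w⟫_ℝ • e - ⟪f, w⟫_ℝ • f, ?_, ?_⟩
  · refine Submodule.mem_inf.2 ⟨?_, Submodule.mem_inf.2 ⟨?_, ?_⟩⟩
    · rw [mem_orthogonal_singleton_iff_inner_right, inner_sub_right, inner_sub_right,
        real_inner_smul_right, real_inner_smul_right, real_inner_comm e f, hef,
        real_inner_self_eq_norm_sq, hf1]
      ring
    · rw [mem_orthogonal_singleton_iff_inner_right, inner_sub_right, inner_sub_right,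
        real_inner_smul_right, real_inner_smul_right, hef, real_inner_self_eq_norm_sq, he1]
      ring
    · exact V.sub_mem (V.sub_mem hwV (V.smul_mem _ he)) (V.smul_mem _ hf)
  · have hsplit : J v - (w - ⟪e, w⟫_ℝ • e - ⟪f, w⟫_ℝ • f) =
        (J v - w) + ⟪e, w⟫_ℝ • e + ⟪f, w⟫_ℝ • f := by abel
    rw [hsplit]
    calc ‖J v - w + ⟪e, w⟫_ℝ • e + ⟪f, w⟫_ℝ • f‖
        ≤ ‖J v - w‖ + ‖⟪e, w⟫_ℝ • e‖ + ‖⟪f, w⟫_ℝ • f‖ := norm_add₃_le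
      _ ≤ t * ‖v‖ + 2 * t * ‖v‖ + 2 * t * ‖v‖ := by
          rw [norm_smul, norm_smul, he1, hf1, mul_one, mul_one, Real.norm_eq_abs, Real.norm_eq_abs]
          exact add_le_add (add_le_add hwt hew_le) hfw_le
      _ = (5 * t) * ‖v‖ := by ring

/-- The complement `V ∩ e^⊥ ∩ f^⊥` of an orthonormal pair `e, f ∈ V` has dimension `dim V - 2`.
[folklore] -/
theorem finrank_inf_orthogonal_pair {V : Submodule ℝ F} {e f : F} (he : e ∈ V) (hf : f ∈ V)
    (he1 : ‖e‖ = 1) (hf1 : ‖f‖ = 1) (hef : ⟪e, f⟫_ℝ = 0) {d : ℕ} (hd : finrank ℝ V = d + 2) :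
    finrank ℝ ((ℝ ∙ f)ᗮ ⊓ ((ℝ ∙ e)ᗮ ⊓ V) : Submodule ℝ F) = d := by
  have he0 : e ≠ 0 := by rw [← norm_ne_zero_iff, he1]; exact one_ne_zero
  have hf0 : f ≠ 0 := by rw [← norm_ne_zero_iff, hf1]; exact one_ne_zero
  have h1 : finrank ℝ ((ℝ ∙ e)ᗮ ⊓ V : Submodule ℝ F) = d + 1 := by
    have h := finrank_add_inf_finrank_orthogonal ((span_singleton_le_iff_mem e V).2 he)
    rw [finrank_span_singleton he0, hd] at h
    omega
  have hfmem : f ∈ ((ℝ ∙ e)ᗮ ⊓ V : Submodule ℝ F) :=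
    Submodule.mem_inf.2 ⟨(mem_orthogonal_singleton_iff_inner_right).2 hef, hf⟩
  have h := finrank_add_inf_finrank_orthogonal ((span_singleton_le_iff_mem f _).2 hfmem)
  rw [finrank_span_singleton hf0, h1] at h
  omega

/-! ### Adapted orthonormal bases -/

/-- **Adapted orthonormal bases of nearly complex planes.** Let `V ⊆ F` be a real subspace of
dimension `2m` which is nearly complex with defect `≤ t` (for the skew isometry `J`), where `0 ≤ t`
and `2 · 5ᵐ · t ≤ 1`. Then there are vectors `e₁, …, e_m, f₁, …, f_m ∈ V`, orthonormal all together
(hence an orthonormal basis of `V`), with `‖f_j - J e_j‖ ≤ 2 · 5ᵐ · t` for all `j`: frame by frame,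
`V` is within `O(t)` of the `J`-complex `m`-plane spanned by the `e_j` (for `t = 0`, `f_j = J e_j` and
`V` is `J`-stable). Greedy induction: `exists_partner_of_defect`, then recurse in `V ∩ e₁^⊥ ∩ f₁^⊥`
(`defect_inf_orthogonal_le`, `finrank_inf_orthogonal_pair`).
[cite: McDuffSalamon2017, §2.5] [cite: HarveyLawson1982, §II.1] -/
theorem exists_adapted_orthonormal_of_defect {J : F →ₗᵢ[ℝ] F} (hJ : ∀ x y, ⟪J x, y⟫_ℝ = -⟪x, J y⟫_ℝ)
    (m : ℕ) :
    ∀ (V : Submodule ℝ F) (t : ℝ), 0 ≤ t → 2 * 5 ^ m * t ≤ 1 → finrank ℝ V = 2 * m →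
      (∀ v ∈ V, ∃ w ∈ V, ‖J v - w‖ ≤ t * ‖v‖) →
      ∃ e f : Fin m → F, (∀ j, e j ∈ V) ∧ (∀ j, f j ∈ V) ∧ (∀ j, ‖e j‖ = 1) ∧ (∀ j, ‖f j‖ = 1) ∧
        (∀ i j, i ≠ j → ⟪e i, e j⟫_ℝ = 0) ∧ (∀ i j, i ≠ j → ⟪f i, f j⟫_ℝ = 0) ∧
        (∀ i j, ⟪e i, f j⟫_ℝ = 0) ∧ ∀ j, ‖f j - J (e j)‖ ≤ 2 * 5 ^ m * t := by
  induction m with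
  | zero =>
    intro V t _ _ _ _
    exact ⟨Fin.elim0, Fin.elim0, fun j ↦ j.elim0, fun j ↦ j.elim0, fun j ↦ j.elim0, fun j ↦ j.elim0,
      fun i ↦ i.elim0, fun i ↦ i.elim0, fun i ↦ i.elim0, fun j ↦ j.elim0⟩
  | succ m ih =>
    intro V t ht hmt hdim hV
    have h5 : (1 : ℝ) ≤ 5 ^ m := one_le_pow₀ (by norm_num)
    have ht2 : t ≤ 1 / 2 := by rw [pow_succ] at hmt; nlinarith
    -- a unit vector `e ∈ V`
    obtain ⟨v, hvV, hv0⟩ : ∃ v ∈ V, v ≠ 0 := by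
      refine V.exists_mem_ne_zero_of_ne_bot fun hbot ↦ ?_
      rw [hbot, finrank_bot] at hdim
      omega
    have hvpos : 0 < ‖v‖ := norm_pos_iff.2 hv0
    set e : F := ‖v‖⁻¹ • v with he_def
    have heV : e ∈ V := V.smul_mem _ hvV
    have he1 : ‖e‖ = 1 := by rw [he_def, norm_smul, norm_inv, norm_norm, inv_mul_cancel₀ hvpos.ne']
    -- its partner `f`
    obtain ⟨f, hfV, hf1, hef, hfe⟩ := exists_partner_of_defect hJ ht2 hV heV he1
    -- recurse in `V' = V ∩ e^⊥ ∩ f^⊥`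
    set V' : Submodule ℝ F := (ℝ ∙ f)ᗮ ⊓ ((ℝ ∙ e)ᗮ ⊓ V) with hV'_def
    have hV'le : V' ≤ V := inf_le_right.trans inf_le_right
    have hdim' : finrank ℝ V' = 2 * m :=
      finrank_inf_orthogonal_pair heV hfV he1 hf1 hef (by rw [hdim]; ring)
    have hV' := defect_inf_orthogonal_le hJ hV heV hfV he1 hf1 hef hfe
    obtain ⟨e', f', he'V, hf'V, he'1, hf'1, he'e', hf'f', he'f', hbd⟩ :=
      ih V' (5 * t) (by positivity) (by rw [pow_succ] at hmt; linarith) hdim' hV'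
    -- orthogonality to `e` and `f` of the vectors of `V'`
    have hperp : ∀ x ∈ V', ⟪e, x⟫_ℝ = 0 ∧ ⟪f, x⟫_ℝ = 0 := fun x hx ↦
      ⟨(mem_orthogonal_singleton_iff_inner_right).1 (Submodule.mem_inf.1 (Submodule.mem_inf.1 hx).2).1,
        (mem_orthogonal_singleton_iff_inner_right).1 (Submodule.mem_inf.1 hx).1⟩
    refine ⟨Matrix.vecCons e e', Matrix.vecCons f f', ?_, ?_, ?_, ?_, ?_, ?_, ?_, ?_⟩
    · refine Fin.cases (by simpa using heV) (fun j ↦ ?_)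
      simpa using hV'le (he'V j)
    · refine Fin.cases (by simpa using hfV) (fun j ↦ ?_)
      simpa using hV'le (hf'V j)
    · exact Fin.cases (by simpa using he1) (fun j ↦ by simpa using he'1 j)
    · exact Fin.cases (by simpa using hf1) (fun j ↦ by simpa using hf'1 j)
    · refine Fin.cases (Fin.cases (fun h ↦ (h rfl).elim) (fun j _ ↦ ?_))
        (fun i ↦ Fin.cases (fun _ ↦ ?_) (fun j hij ↦ ?_))
      · simpa using (hperp _ (he'V j)).1
      · simpa [real_inner_comm] using (hperp _ (he'V i)).1
      · simpa using he'e' i j fun h ↦ hij (congrArg Fin.succ h)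
    · refine Fin.cases (Fin.cases (fun h ↦ (h rfl).elim) (fun j _ ↦ ?_))
        (fun i ↦ Fin.cases (fun _ ↦ ?_) (fun j hij ↦ ?_))
      · simpa using (hperp _ (hf'V j)).2
      · simpa [real_inner_comm] using (hperp _ (hf'V i)).2
      · simpa using hf'f' i j fun h ↦ hij (congrArg Fin.succ h)
    · refine Fin.cases (Fin.cases (by simpa using hef) (fun j ↦ ?_))
        (fun i ↦ Fin.cases ?_ (fun j ↦ ?_))
      · simpa using (hperp _ (hf'V j)).1
      · simpa [real_inner_comm] using (hperp _ (he'V i)).2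
      · simpa using he'f' i j
    · refine Fin.cases ?_ (fun j ↦ ?_)
      · have : 2 * t ≤ 2 * 5 ^ (m + 1) * t := by
          rw [pow_succ]; nlinarith
        simpa using hfe.trans this
      · have h := hbd j
        have : 2 * 5 ^ m * (5 * t) = 2 * 5 ^ (m + 1) * t := by ring
        simpa [this] using h

end SkewIsometry

/-! ### The complex case: `J = i •` on a complex inner product space -/

section Complex

variable {E : Type*} [NormedAddCommGroup E] [InnerProductSpace ℂ E]

/-- `‖i x‖ = ‖x‖`: multiplication by `i` is a real isometry of a complex normed space. [folklore] -/
theorem norm_I_smul_eq (x : E) : ‖Complex.I • x‖ = ‖x‖ := by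
  rw [norm_smul, Complex.norm_I, one_mul]

variable [FiniteDimensional ℂ E]

/-- **Adapted orthonormal bases of nearly complex planes, complex case.** Let `E` be a
finite-dimensional complex inner product space, `V ⊆ E` a real subspace of dimension `2m` which is
nearly complex with defect `≤ t` (`‖iv - w‖ ≤ t‖v‖` for some `w ∈ V`, every `v ∈ V`), `0 ≤ t`,
`2 · 5ᵐ · t ≤ 1`. Then there are `e₁, …, e_m, f₁, …, f_m ∈ V`, unit vectors, pairwise orthogonal
for the real inner product `re ⟪·, ·⟫_ℂ`, with `‖f_j - i e_j‖ ≤ 2 · 5ᵐ · t`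
(`exists_adapted_orthonormal_of_defect` for `J = i •`, a real isometry, skew for `re ⟪·, ·⟫_ℂ`).
[cite: McDuffSalamon2017, §2.5] [cite: HarveyLawson1982, §II.1] -/
theorem exists_adapted_orthonormal_of_defect_complex (m : ℕ) (V : Submodule ℝ E) (t : ℝ)
    (ht : 0 ≤ t) (hmt : 2 * 5 ^ m * t ≤ 1) (hdim : finrank ℝ V = 2 * m)
    (hV : ∀ v ∈ V, ∃ w ∈ V, ‖Complex.I • v - w‖ ≤ t * ‖v‖) :
    ∃ e f : Fin m → E, (∀ j, e j ∈ V) ∧ (∀ j, f j ∈ V) ∧ (∀ j, ‖e j‖ = 1) ∧ (∀ j, ‖f j‖ = 1) ∧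
      (∀ i j, i ≠ j → (⟪e i, e j⟫_ℂ).re = 0) ∧ (∀ i j, i ≠ j → (⟪f i, f j⟫_ℂ).re = 0) ∧
      (∀ i j, (⟪e i, f j⟫_ℂ).re = 0) ∧ ∀ j, ‖f j - Complex.I • e j‖ ≤ 2 * 5 ^ m * t := by
  letI : InnerProductSpace ℝ E := InnerProductSpace.complexToReal
  let J : E →ₗᵢ[ℝ] E :=
    { toLinearMap := (Complex.I • LinearMap.id : E →ₗ[ℂ] E).restrictScalars ℝ
      norm_map' := fun x ↦ by simpa using norm_I_smul_eq x }
  have hJapply : ∀ x, J x = Complex.I • x := fun x ↦ rfl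
  have hJ : ∀ x y, ⟪J x, y⟫_ℝ = -⟪x, J y⟫_ℝ := by
    intro x y
    rw [hJapply, hJapply, real_inner_eq_re_inner ℂ, real_inner_eq_re_inner ℂ, inner_smul_left,
      inner_smul_right, Complex.conj_I]
    simp
  obtain ⟨e, f, heV, hfV, he1, hf1, hee, hff, hef, hbd⟩ :=
    exists_adapted_orthonormal_of_defect hJ m V t ht hmt hdim (by simpa only [hJapply] using hV)
  exact ⟨e, f, heV, hfV, he1, hf1, hee, hff, hef, by simpa only [hJapply] using hbd⟩

end Complex

end Literature.Geometry.Kaehler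

end
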